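/-
Copyright (c) 2026. All rights reserved.
Released under Apache 2.0 license as described in the file LICENSE.
Authors: abc-iut cell, seat abc-iut-L4-t14 (gen 2; proof-only: the shape of the printed deduction
"id-rigidity of `EA` ⇐ id-rigidity of the full subcategories of objects mapping to `X`" made a theorem,
and its specialisation to the geometric `EA` of GAP row G-w5d226-1).
-/
import Literature.AnabelianGeometry.AbsoluteAnabelian.RigidFunctors
import Literature.AnabelianGeometry.AbsoluteAnabelian.ArchimedeanHolFieldFunctorGeometricRC
import Mathlib.CategoryTheory.ObjectProperty.FullSubcategory
import HarnessLib

/-!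
# Id-rigidity is local: rigid functors through every object; the print route for `EA`

S. Mochizuki, *Topics in absolute anabelian geometry III*, §0 p. 27 (rigid functors, id-rigid categories)
and the proof of Prop 4.2 (i) p. 106 l. 14–19 (kurims manuscript `paper:url-5493eb38cbb7`; bib key
`MochizukiAbsTopIII2015`): "To verify the id-rigidity of `EA`, it suffices to observe that for any object
`𝕏 ∈ Ob(EA)` …, the full subcategory of `EA` consisting of objects that map to `𝕏` may, by Corollary 2.3,
(i), be identified with the category of finite étale R-localizations '`Loc_R(X)`' …. Thus, the id-rigidity
of `EA` follows immediately from the slimness assertion of Lemma 4.3 below."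

PROOF-ONLY toolkit (no new notion) making the SHAPE of that deduction a theorem, over abc-iut-L4-t2's
`IsRigidFunctor` / `IsIdRigid` and the `RigidFunctors` lemmas:

* `isIdRigid_of_rigid_functors_through` — if through every object `X` of `C` there passes a RIGID functor
  (`G_X : D_X ⥤ C` with `X ≅ G_X d_X`), then `C` is id-rigid (whisker an automorphism of `𝟭_C` along `G_X`);
* `isIdRigid_of_fullyFaithful_through` — in particular if the `G_X` are fully faithful out of ID-RIGID
  categories (`isRigidFunctor_of_full_faithful`);
* `isIdRigid_of_forall_isIdRigid_mapsTo` — **print's shape**: if for every `X` the full subcategory of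
  "objects that map to `X`" is id-rigid, then `C` is id-rigid (the inclusion is fully faithful and
  contains `X` via `𝟙_X`);
* specialisations to the geometric `EA` of abc-iut-L4-t14's `ArchimedeanHolFieldFunctorGeometric(RC).lean`
  (`HolRS.isIdRigid_EA_of_forall_isIdRigid_mapsTo`, `…RC…`) and the resulting form of Cor 4.5 over
  geometric carriers (`HolRS.cor_4_5_geometric_of_forall_isIdRigid_mapsTo`): the ONE remaining
  hypothesis of the geometric model becomes, object by object, «the full subcategory of finite étale
  (RC-)holomorphic maps INTO `𝕏` is id-rigid» — in print `≅ Loc_R(X)`, id-rigid by the slimness of `Π_X`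
  (Lemma 4.3; abc-iut-L4-t10's `isIdRigid_EA_ofGaloisCategory` is the Galois-category form), the
  identification being Riemann's existence theorem — campaign-L, NOT proved here.

Refereed pre-IUT category theory / anabelian geometry; nothing here bears on [IUTchIII] Cor. 3.12 or
takes a side; typed ≠ discharged.
-/

set_option autoImplicit false

namespace Literature.AnabelianGeometry.AbsoluteAnabelian

open _root_.CategoryTheory

universe v u

section Local

variable {C : Type u} [Category.{v} C]

/-- **Id-rigidity is local**: if through every object `X` of `C` passes a rigid functor `G_X : D_X ⥤ C`
(`X ≅ G_X d_X`), then `C` is id-rigid — an automorphism `α` of `𝟭_C` whiskers to an automorphism of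
`G_X`, which is trivial, so `α_{G_X d_X} = id`, hence `α_X = id` by naturality along `X ≅ G_X d_X`.
[cite: MochizukiAbsTopIII2015, Section 0 p.27] -/
theorem isIdRigid_of_rigid_functors_through (D : C → Type u) [∀ X, Category.{v} (D X)]
    (G : ∀ X, D X ⥤ C) (hG : ∀ X, IsRigidFunctor (G X)) (d : ∀ X, D X)
    (e : ∀ X, (G X).obj (d X) ≅ X) : IsIdRigid C := by
  refine isRigidFunctor_of_hom_app_eq_id fun α X => ?_
  -- whisker `α` along `G X`: an automorphism of `G X` with components `α_{G y}`
  let β : G X ≅ G X := NatIso.ofComponents (fun y => α.app ((G X).obj y)) (fun f => by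
    simpa using α.hom.naturality ((G X).map f))
  have h1 : α.hom.app ((G X).obj (d X)) = 𝟙 _ := (hG X).hom_app_eq_id β (d X)
  -- naturality along `e X`
  have nat : (e X).hom ≫ α.hom.app X = (e X).hom := by
    simpa [h1] using α.hom.naturality (e X).hom
  have h2 : (e X).hom ≫ α.hom.app X = (e X).hom ≫ 𝟙 X := by rw [nat, Category.comp_id]
  simpa using (cancel_epi (e X).hom).1 h2

/-- Through every object a FULLY FAITHFUL functor out of an id-rigid category ⇒ `C` is id-rigid
(`isRigidFunctor_of_full_faithful`). [cite: MochizukiAbsTopIII2015, Section 0 p.27] -/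
theorem isIdRigid_of_fullyFaithful_through (D : C → Type u) [∀ X, Category.{v} (D X)]
    (G : ∀ X, D X ⥤ C) [∀ X, (G X).Full] [∀ X, (G X).Faithful] (hD : ∀ X, IsIdRigid (D X))
    (d : ∀ X, D X) (e : ∀ X, (G X).obj (d X) ≅ X) : IsIdRigid C :=
  isIdRigid_of_rigid_functors_through D G (fun X => isRigidFunctor_of_full_faithful (G X) (hD X)) d e

/-- The object property "maps to `X`": `Y` admits a morphism `Y ⟶ X` ("the full subcategory of `EA`
consisting of objects that map to `𝕏`"). [cite: MochizukiAbsTopIII2015, Proposition 4.2 (i) p.106] -/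
theorem mapsTo_self (X : C) : (fun Y : C => Nonempty (Y ⟶ X)) X := ⟨𝟙 X⟩

/-- **Print's shape: id-rigidity of `C` from the id-rigidity of the full subcategories of objects mapping
to each `X`** ("for any object `𝕏` …, the full subcategory … consisting of objects that map to `𝕏` …
[is id-rigid]. Thus, the id-rigidity of `EA` follows").  The inclusion of a full subcategory is fully
faithful and `X` lies in it by `𝟙_X`. [cite: MochizukiAbsTopIII2015, Proposition 4.2 (i) p.106] -/
theorem isIdRigid_of_forall_isIdRigid_mapsTo
    (h : ∀ X : C, IsIdRigid (ObjectProperty.FullSubcategory fun Y : C => Nonempty (Y ⟶ X))) :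
    IsIdRigid C :=
  isIdRigid_of_fullyFaithful_through
    (fun X => ObjectProperty.FullSubcategory fun Y : C => Nonempty (Y ⟶ X))
    (fun _ => ObjectProperty.ι _) h (fun X => ⟨X, mapsTo_self X⟩) (fun _ => Iso.refl _)

end Local

/-! ### Specialisation to the geometric `EA` (GAP row G-w5d226-1) -/

namespace HolRS

/-- **The one hypothesis of the geometric model, localised** (holomorphic instance): `EA^hol_RS(Q)` is
id-rigid as soon as, for every object `𝕏`, the full subcategory of connected Riemann surfaces in `Q` that
admit a holomorphic finite étale map INTO `𝕏` is id-rigid — print: "`≅ Loc_R(X)`", id-rigid "from the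
slimness assertion of Lemma 4.3" (the identification is Riemann's existence theorem; campaign-L).
[cite: MochizukiAbsTopIII2015, Proposition 4.2 (i) p.106] -/
theorem isIdRigid_EA_of_forall_isIdRigid_mapsTo (Q : ObjectProperty HolRS)
    (h : ∀ X : (geometricAutHolFieldFunctor Q).EA,
      IsIdRigid (ObjectProperty.FullSubcategory fun Y : (geometricAutHolFieldFunctor Q).EA =>
        Nonempty (Y ⟶ X))) :
    IsIdRigid (geometricAutHolFieldFunctor Q).EA :=
  isIdRigid_of_forall_isIdRigid_mapsTo h

/-- The same for the RC-holomorphic (print-faithful, `TH`-morphism) instance `EA^RC_RS(Q)`.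
[cite: MochizukiAbsTopIII2015, Proposition 4.2 (i) p.106] -/
theorem isIdRigid_EA_RC_of_forall_isIdRigid_mapsTo (Q : ObjectProperty RC)
    (h : ∀ X : (geometricAutHolFieldFunctorRC Q).EA,
      IsIdRigid (ObjectProperty.FullSubcategory fun Y : (geometricAutHolFieldFunctorRC Q).EA =>
        Nonempty (Y ⟶ X))) :
    IsIdRigid (geometricAutHolFieldFunctorRC Q).EA :=
  isIdRigid_of_forall_isIdRigid_mapsTo h

/-- **Cor 4.5 over geometric carriers in print's shape**: Cor 4.5 (i)–(v) for the archimedean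
log-Frobenius data over `EA^RC_RS(Q)` from one object and the id-rigidity of every "objects mapping to
`𝕏`" full subcategory (⇐ `Loc_R(X)` + Lemma 4.3 in print). [cite: MochizukiAbsTopIII2015, Corollary 4.5 pp.107–109] -/
theorem cor_4_5_geometricRC_of_forall_isIdRigid_mapsTo (Q : ObjectProperty RC)
    (X₀ : (geometricAutHolFieldFunctorRC Q).EA)
    (h : ∀ X : (geometricAutHolFieldFunctorRC Q).EA,
      IsIdRigid (ObjectProperty.FullSubcategory fun Y : (geometricAutHolFieldFunctorRC Q).EA =>
        Nonempty (Y ⟶ X))) :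
    Literature.AnabelianGeometry.AbsoluteAnabelian.AbsTopIII.Cor_4_5
      (archLogFrobeniusData (geometricAutHolFieldFunctorRC Q))
      (archTelecoreData (geometricAutHolFieldFunctorRC Q)) :=
  cor_4_5_geometricRC Q X₀ (isIdRigid_EA_RC_of_forall_isIdRigid_mapsTo Q h)

end HolRS

end Literature.AnabelianGeometry.AbsoluteAnabelian
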